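import Summits.SmoothPoincare4.SmoothPoincare4.Theorems.CylinderEntropyCylinderRungTwoKillingIdentity
import Literature.Geometry.Lorentzian.VolumePositivity
import Mathlib.MeasureTheory.Measure.OpenPos
import HarnessLib

/-!
# Route `CylinderEntropy`, crux `CylinderRungTwo` (stmt-SmoothPoincare4-7631), line `killing-flux`:
# NO CLOSED TRANSLATORS IN `S⁴ × ℝ` (rigidity layer R2-H,
# registered helper `helper_translatorIsMinimal`)

For a closed immersed cross-section `f : M⁴ → N = S⁴ × ℝ = {z ∈ ℝ⁶ | ∑_{i<5} zᵢ² = 1}` with smooth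
unit normal `ν` tangent to `N`, mean curvature `H` (tree `meanCurvature` of `(f, ν)` in `ℝ⁶`) and
induced metric `g = f^*δ` (`μ_g = riemannianMeasure g`): if `(f, ν)` is a TRANSLATING SOLITON of the
mean curvature flow in the vertical direction `e₅` with speed `a`, i.e. `H = a ν₅` pointwise, then
`f` is MINIMAL, `H ≡ 0`.

Proof. The Killing identity `∫_M H ν₅ dμ_g = 0` (`killing_identity`, the first variation of area
along the parallel vertical field `e₅`) becomes `a ∫_M ν₅² dμ_g = 0` after substituting `H = a ν₅`
(`mul_integral_sq_apply_five_eq_zero_of_translator`). If `a = 0` then `H = 0 · ν₅ = 0`. If `a ≠ 0`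
then `∫_M ν₅² dμ_g = 0`; the integrand is continuous, nonnegative and integrable on the compact `M`
(`integrable_of_continuous`, the Riemannian measure of a closed manifold is finite), so it vanishes
`μ_g`-a.e. (Mathlib's `integral_eq_zero_iff_of_nonneg`), hence everywhere, because the Riemannian
measure charges every nonempty open set (`isOpenPosMeasure_riemannianMeasure`, Federer 1969,
§3.2.46, and Mathlib's `Continuous.ae_eq_iff_eq`): `ν₅ ≡ 0`
(`apply_five_eq_zero_of_integral_sq_eq_zero`), and again `H = a ν₅ = 0`.

* `mul_integral_sq_apply_five_eq_zero_of_translator` — `a ∫_M ν₅² dμ_g = 0` for a translator;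
* `apply_five_eq_zero_of_integral_sq_eq_zero` — `∫_M ν₅² dμ_g = 0 ⟹ ν₅ ≡ 0`;
* `meanCurvature_eq_zero_of_translator` — the statement with implicit binders;
* `helper_translatorIsMinimal` — the registered helper, verbatim.

Everything here is PROVED (no `sorry`, no new definitions, no named facts).

References: R. S. Hamilton, Comm. Anal. Geom. 1 (1993) 127–137, §4 (first variation on slices of
`S⁴ × ℝ`; no closed translators); H. Federer, *Geometric Measure Theory* (1969), §3.2.46 (the
Riemannian measure is a positive smooth density in charts).
-/

-- the prescribed namespace `Summit.SmoothPoincare4.SmoothPoincare4.…` repeats `SmoothPoincare4`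
set_option linter.dupNamespace false

noncomputable section

open Set Function Filter MeasureTheory
open scoped Manifold ContDiff Topology

namespace Summit.SmoothPoincare4.SmoothPoincare4.Cruxes.CylinderRungTwo.KillingFlux

open Literature.Geometry.Riemannian Literature.Geometry.Lorentzian
  Literature.Geometry.Lorentzian.PseudoRiemannianMetric

/-! ## Translating solitons are minimal -/

/-- **The Killing identity for a translator**: for a closed immersed cross-section
`f : M⁴ → N = S⁴ × ℝ` with smooth unit normal `ν` tangent to `N` and mean curvature `H = a ν₅`
(a translating soliton in the direction `e₅` with speed `a`), `a ∫_M ν₅² dμ_g = 0`: substitute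
`H = a ν₅` into the Killing identity `∫_M H ν₅ dμ_g = 0` (`killing_identity`) and pull out the
constant. [cite: Hamilton1993, §4] -/
theorem mul_integral_sq_apply_five_eq_zero_of_translator {M : Type*} [TopologicalSpace M]
    [ChartedSpace (EuclideanSpace ℝ (Fin 4)) M] [IsManifold (𝓡 4) ∞ M] [CompactSpace M]
    [T2Space M] [MeasurableSpace M] [BorelSpace M] {f νf : M → EuclideanSpace ℝ (Fin 6)}
    (hf : (euclideanMetric (EuclideanSpace ℝ (Fin 6))).IsSpacelikeImmersion (𝓡 4) f)
    (hν : ContMDiff (𝓡 4) 𝓘(ℝ, EuclideanSpace ℝ (Fin 6)) ∞ νf)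
    (hun : (euclideanMetric (EuclideanSpace ℝ (Fin 6))).IsUnitNormal (𝓡 4) f νf 1)
    (hN : ∀ x, ∑ i : Fin 5, f x (Fin.castSucc i) ^ 2 = 1)
    (hνN : ∀ x, ∑ i : Fin 5, νf x (Fin.castSucc i) * f x (Fin.castSucc i) = 0) {a : ℝ}
    (hH : ∀ x, (euclideanMetric (EuclideanSpace ℝ (Fin 6))).meanCurvature f
      contMDiff_pullbackBilin_holds hf νf x = a * νf x 5) :
    a * ∫ w, νf w 5 ^ 2 ∂riemannianMeasure ((euclideanMetric (EuclideanSpace ℝ (Fin 6))).inducedRiemannianMetric f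
        contMDiff_pullbackBilin_holds hf) = 0 := by
  have h0 := killing_identity hf hν hun hN hνN
  have h1 : (fun w => (euclideanMetric (EuclideanSpace ℝ (Fin 6))).meanCurvature f
      contMDiff_pullbackBilin_holds hf νf w * νf w 5) = fun w => a * νf w 5 ^ 2 := by
    funext w
    rw [hH w]
    ring
  rw [h1, integral_const_mul] at h0
  exact h0

/-- **A vanishing `∫_M ν₅² dμ_g` forces `ν₅ ≡ 0`.** For a closed immersed cross-section
`f : M⁴ → ℝ⁶` with `g = f^*δ` and a continuous field `ν` along `f`: if `∫_M ν₅² dμ_g = 0` then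
`ν₅(x) = 0` for every `x` (the integrand is continuous and nonnegative, the Riemannian measure is
finite and positive on nonempty open sets). [cite: Federer1969, §3.2.46] -/
theorem apply_five_eq_zero_of_integral_sq_eq_zero {M : Type*} [TopologicalSpace M]
    [ChartedSpace (EuclideanSpace ℝ (Fin 4)) M] [IsManifold (𝓡 4) ∞ M] [CompactSpace M]
    [T2Space M] [MeasurableSpace M] [BorelSpace M] {f νf : M → EuclideanSpace ℝ (Fin 6)}
    (hf : (euclideanMetric (EuclideanSpace ℝ (Fin 6))).IsSpacelikeImmersion (𝓡 4) f)
    (hνc : Continuous νf)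
    (h0 : ∫ w, νf w 5 ^ 2 ∂riemannianMeasure ((euclideanMetric (EuclideanSpace ℝ (Fin 6))).inducedRiemannianMetric f
        contMDiff_pullbackBilin_holds hf) = 0)
    (x : M) : νf x 5 = 0 := by
  set g₁ := (euclideanMetric (EuclideanSpace ℝ (Fin 6))).inducedRiemannianMetric f
    contMDiff_pullbackBilin_holds hf
  -- the integrand is continuous, nonnegative and integrable
  have h5 : Continuous fun z : EuclideanSpace ℝ (Fin 6) => z 5 :=
    (EuclideanSpace.proj (5 : Fin 6) : EuclideanSpace ℝ (Fin 6) →L[ℝ] ℝ).continuous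
  have hFc : Continuous fun w => νf w 5 ^ 2 := (h5.comp hνc).pow 2
  have hFi : Integrable (fun w => νf w 5 ^ 2) (riemannianMeasure g₁) :=
    integrable_of_continuous (h := g₁) hFc
  -- `∫ F = 0` with `F ≥ 0` integrable: `F = 0` a.e.
  have hae : (fun w => νf w 5 ^ 2) =ᵐ[riemannianMeasure g₁] 0 :=
    (integral_eq_zero_iff_of_nonneg (fun w => sq_nonneg (νf w 5)) hFi).1 h0
  -- the Riemannian measure charges nonempty open sets: a continuous a.e.-zero function is zero
  haveI : (riemannianMeasure g₁).IsOpenPosMeasure := isOpenPosMeasure_riemannianMeasure g₁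
  have heq : (fun w => νf w 5 ^ 2) = 0 :=
    (hFc.ae_eq_iff_eq (riemannianMeasure g₁) continuous_const).1 hae
  exact pow_eq_zero_iff (n := 2) two_ne_zero |>.1 (congr_fun heq x)

/-- **No closed translators in `S⁴ × ℝ`**: for a closed immersed cross-section
`f : M⁴ → N = S⁴ × ℝ` with smooth unit normal `ν` tangent to `N`, if the mean curvature is
`H = a ν₅` (a translating soliton of mean curvature flow in the vertical direction `e₅` with speed
`a`), then `H ≡ 0`. Either `a = 0`, or the Killing identity `a ∫_M ν₅² dμ_g = 0`
(`mul_integral_sq_apply_five_eq_zero_of_translator`) gives `∫_M ν₅² dμ_g = 0`, hence `ν₅ ≡ 0`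
(`apply_five_eq_zero_of_integral_sq_eq_zero`); in both cases `H = a ν₅ = 0`.
[cite: Hamilton1993, §4] -/
theorem meanCurvature_eq_zero_of_translator {M : Type*} [TopologicalSpace M]
    [ChartedSpace (EuclideanSpace ℝ (Fin 4)) M] [IsManifold (𝓡 4) ∞ M] [CompactSpace M]
    [T2Space M] [MeasurableSpace M] [BorelSpace M] {f νf : M → EuclideanSpace ℝ (Fin 6)}
    (hf : (euclideanMetric (EuclideanSpace ℝ (Fin 6))).IsSpacelikeImmersion (𝓡 4) f)
    (hν : ContMDiff (𝓡 4) 𝓘(ℝ, EuclideanSpace ℝ (Fin 6)) ∞ νf)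
    (hun : (euclideanMetric (EuclideanSpace ℝ (Fin 6))).IsUnitNormal (𝓡 4) f νf 1)
    (hN : ∀ x, ∑ i : Fin 5, f x (Fin.castSucc i) ^ 2 = 1)
    (hνN : ∀ x, ∑ i : Fin 5, νf x (Fin.castSucc i) * f x (Fin.castSucc i) = 0) {a : ℝ}
    (hH : ∀ x, (euclideanMetric (EuclideanSpace ℝ (Fin 6))).meanCurvature f
      contMDiff_pullbackBilin_holds hf νf x = a * νf x 5) (x : M) :
    (euclideanMetric (EuclideanSpace ℝ (Fin 6))).meanCurvature f contMDiff_pullbackBilin_holds hf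
      νf x = 0 := by
  rw [hH x]
  rcases eq_or_ne a 0 with rfl | ha
  · rw [zero_mul]
  · have hint := (mul_eq_zero.1
      (mul_integral_sq_apply_five_eq_zero_of_translator hf hν hun hN hνN hH)).resolve_left ha
    rw [apply_five_eq_zero_of_integral_sq_eq_zero hf hν.continuous hint x, mul_zero]

/-- **Registered helper `helper_translatorIsMinimal` of line `killing-flux` (rigidity layer R2-H:
no compact translating solitons in `N = S⁴ × ℝ`).** For a closed immersed cross-section
`f : M⁴ → N` of a compact non-empty `M` with smooth unit normal `ν` tangent to `N`: if the mean
curvature of `(f, ν)` is `H = a ν₅` for a constant `a`, then `H ≡ 0`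
(`meanCurvature_eq_zero_of_translator`: the Killing identity `∫_M H ν₅ dμ_g = 0` gives
`a ∫_M ν₅² dμ_g = 0`, so `a = 0` or `ν₅ ≡ 0`). [cite: Hamilton1993, §4] -/
theorem helper_translatorIsMinimal :
    ∀ (M : Type) [TopologicalSpace M] [T2Space M] [SecondCountableTopology M]
      [ChartedSpace (EuclideanSpace ℝ (Fin 4)) M] [IsManifold (𝓡 4) ∞ M] [CompactSpace M]
      [Nonempty M] [MeasurableSpace M] [BorelSpace M] (f νf : M → EuclideanSpace ℝ (Fin 6))
      (hf : (Literature.Geometry.Riemannian.euclideanMetric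
        (EuclideanSpace ℝ (Fin 6))).IsSpacelikeImmersion (𝓡 4) f),
      ContMDiff (𝓡 4) (𝓡 6) ∞ νf →
      (Literature.Geometry.Riemannian.euclideanMetric
        (EuclideanSpace ℝ (Fin 6))).IsUnitNormal (𝓡 4) f νf 1 →
      (∀ x, ∑ i : Fin 5, f x (Fin.castSucc i) ^ 2 = 1) →
      (∀ x, ∑ i : Fin 5, νf x (Fin.castSucc i) * f x (Fin.castSucc i) = 0) →
      ∀ a : ℝ, (∀ x, (Literature.Geometry.Riemannian.euclideanMetric
        (EuclideanSpace ℝ (Fin 6))).meanCurvature f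
          Literature.Geometry.Lorentzian.PseudoRiemannianMetric.contMDiff_pullbackBilin_holds hf
          νf x = a * νf x 5) →
      ∀ x, (Literature.Geometry.Riemannian.euclideanMetric
        (EuclideanSpace ℝ (Fin 6))).meanCurvature f
          Literature.Geometry.Lorentzian.PseudoRiemannianMetric.contMDiff_pullbackBilin_holds hf
          νf x = 0 :=
  fun _ _ _ _ _ _ _ _ _ _ _ _ hf hν hun hN hνN _ hH x =>
    meanCurvature_eq_zero_of_translator hf hν hun hN hνN hH x

end Summit.SmoothPoincare4.SmoothPoincare4.Cruxes.CylinderRungTwo.KillingFlux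

end
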